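import Literature.AlgebraicGeometry.Motives.FormsOnSections
import Literature.AlgebraicGeometry.Motives.ProjectiveNoetherNormalization
import Literature.AlgebraicGeometry.Resolution.VertexBlowupRationalFunctions
import Literature.AlgebraicGeometry.Resolution.StrictNormalCrossingsPoints
import Literature.AlgebraicGeometry.Resolution.PointBlowupProjectionRingHom
import HarnessLib

/-!
# De Jong 1996, Lemma 4.11: the projection `π = (t₀ : … : t_{d+1}) : X → ℙ^{d+1}` of `d + 2` forms

Topic: `Literature/AlgebraicGeometry/Resolution`. A PROVED layer for the open leaf
`DeJong1996Lemma411VertexChoice` (`AlterationsLemma411Vertex.lean`; de Jong 1996, proof of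
Lemma 4.11, p. 68: "There exists a finite morphism `π : X → ℙ^d` […] To construct such a `π`, we
choose an embedding `X ↪ ℙ^N` and we let `π` be the composition of projection morphisms as in
2.11"). Along the route recorded in `Lemma411VertexChoiceOfProjection.lean` the projection is
taken to be `π = (t₀ : … : t_{d+1})` for `d + 2` FORMS `F_j` of a common degree `e ≥ 1` on the
ambient `ℙ^N` without common zero on `X` — exactly as in the tree's projective Noether
normalisation (`Motives/ProjectiveNoetherNormalization`: forms of high degree instead of linear
projections). This file constructs that `π` and proves what the leaf's reduction
(`DeJong1996.Lemma411GoodProjection`) needs about it BEFORE any genericity: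

Let `X` be an integral proper `k`-scheme, `E` a Cartier divisor with global sections
`s₀, …, s_N ∈ Γ(X, 𝒪_X(E))` whose non-vanishing loci are affine and cover `X` (an embedding
`ψ : X → ℙ^N`, `ψ^*𝒪(1) = 𝒪_X(E)`), and `F₀, …, F_{d+1} ∈ k[x₀, …, x_N]_e`, `e ≥ 1`, forms whose
sections `t_j = F_j(s)` of `𝒪_X(e E)` (`Motives/FormsOnSections`) have no common zero.

* `DeJong1996.formsProjection … F` — **`π = (t₀ : … : t_{d+1}) : X → ℙ^{d+1}_k`**, the
  morphism of the generating sections `t_j` (`CartierDivisor.toGeneratingSections`,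
  `GeneratingSections.toProj`); over `k` (`formsProjection_toSpec`), AFFINE and FINITE
  (`isFinite_formsProjection`: `π⁻¹ D₊(y_j) = X_{t_j}` is affine, and `X` is proper), SURJECTIVE
  when `dim X = d + 1` (`surjective_formsProjection`);
* `DeJong1996.formsProjection_preimage_basicOpen` — `π⁻¹ D₊(y_j) = X_{t_j}`;
* `DeJong1996.vertex_notMem_image_formsProjection` — **`vertex ∉ π(Z)` as soon as `t₀, …, t_d`
  have no common zero on `Z`**;
* `DeJong1996.maximalIdeal_stalk_vertex` — the maximal ideal of `𝒪_{ℙ^{d+1}, vertex}` is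
  generated by the germs of the coordinates `xₐ/x_{d+1}`, `a ≤ d`, of the last chart;
* `DeJong1996.map_maximalIdeal_formsProjection` — **for `x ∈ π⁻¹(vertex)`,
  `𝔪_vertex · 𝒪_{X,x}` is the ideal generated by the germs of the ratios `tₐ/t_{d+1}`, `a ≤ d`**
  (`π^*(xₐ/x_{d+1}) = tₐ/t_{d+1}`, `GeneratingSections.app_sec`). So the stalk condition
  `𝔪_vertex 𝒪_{X,x} = 𝔪_x` of `Lemma411GoodProjection` ("`p ∉ B`") reads: the `d + 1` functions
  `tₐ/t_{d+1}` generate the maximal ideal of `𝒪_{X,x}` at every common zero `x` of `t₀, …, t_d`.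

No named fact; [folklore] plumbing, PROVED.

## Sources

* A. J. de Jong, *Smoothness, semi-stability and alterations*, Publ. Math. IHÉS 83 (1996),
  2.11 (p. 56) and the proof of Lemma 4.11 (p. 68). [DeJong1996]
* U. Görtz, T. Wedhorn, *Algebraic Geometry I: Schemes*, 2nd ed. (2020), (13.11)–(13.12),
  Thm. 13.89 (proof). [GortzWedhorn2020]
* R. Hartshorne, *Algebraic Geometry* (1977), II Thm. 7.1. [Hartshorne1977]
-/

noncomputable section

open CategoryTheory CategoryTheory.Limits AlgebraicGeometry TopologicalSpace HomogeneousLocalization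
  IsLocalRing
open MvPolynomial (aeval)

attribute [local instance] MvPolynomial.gradedAlgebra

namespace Literature.AlgebraicGeometry.Resolution

universe u

open Literature.AlgebraicGeometry.Motives
open Literature.AlgebraicGeometry.Motives.Segre (grading chartι toSpec X_mem frac)
open Literature.AlgebraicGeometry.Motives.RatFn

namespace DeJong1996

/-! ## The maximal ideal at the vertex -/

section Vertex

variable (d : ℕ) (k : Type u) [Field k]

/-- The ideal of the vertex in the coordinate ring of the last chart is the span of the
coordinate sections `xₐ/x_{d+1}`, and equals the prime ideal of the point `vertex` of the
affine open `D₊(x_{d+1})`. [folklore] -/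
theorem span_range_vertexSection_eq_primeIdealOf :
    Ideal.span (Set.range (vertexSection d k)) =
      ((lastChart d k).2.primeIdealOf ⟨vertex d k, vertex_mem_lastChart d k⟩).asIdeal := by
  rw [span_range_vertexSection]
  refine vanishingIdeal_ideal_eq_primeIdealOf (isClosed_singleton_vertex d k) (lastChart d k)
    (vertex_mem_lastChart d k) ?_
  ext x
  simp only [Set.mem_inter_iff, Set.mem_singleton_iff, and_iff_right_iff_imp]
  rintro rfl
  exact vertex_mem_lastChart d k

/-- **The maximal ideal of `𝒪_{ℙ^{d+1}, vertex}` is generated by the germs of the coordinates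
`xₐ/x_{d+1}`, `a ≤ d`** (the stalk is the localisation of `Γ(D₊(x_{d+1})) = k[X₀, …, X_d]` at
the ideal `(X₀, …, X_d)` of the vertex). [folklore] -/
theorem maximalIdeal_stalk_vertex :
    maximalIdeal ((Proj (grading (Fin (d + 1 + 1)) k)).presheaf.stalk (vertex d k)) =
      Ideal.span (Set.range fun a : Fin (d + 1) =>
        ((Proj (grading (Fin (d + 1 + 1)) k)).presheaf.germ (lastChart d k) (vertex d k)
          (vertex_mem_lastChart d k)).hom (vertexSection d k a)) := by
  letI := TopCat.Presheaf.algebra_section_stalk (Proj (grading (Fin (d + 1 + 1)) k)).presheaf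
    (⟨vertex d k, vertex_mem_lastChart d k⟩ : (lastChart d k : (Proj (grading (Fin (d + 1 + 1)) k)).Opens))
  haveI := (lastChart d k).2.isLocalization_stalk ⟨vertex d k, vertex_mem_lastChart d k⟩
  rw [← IsLocalization.AtPrime.map_eq_maximalIdeal
      ((lastChart d k).2.primeIdealOf ⟨vertex d k, vertex_mem_lastChart d k⟩).asIdeal
      ((Proj (grading (Fin (d + 1 + 1)) k)).presheaf.stalk (vertex d k)),
    ← span_range_vertexSection_eq_primeIdealOf, Ideal.map_span, ← Set.range_comp]
  rfl

end Vertex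

/-! ## The projection of `d + 2` forms -/

section Forms

variable {k : Type u} [Field k] {X : Scheme.{u}} [IsIntegral X] [X.Over (Spec (.of k))]
  {E : CartierDivisor X} {N : ℕ} {s : Fin (N + 1) → X.functionField}
  (hs : ∀ i, E.IsSection (s i)) (hξ : ∀ i, genericPoint X ∈ E.nonvanishingOpens (s i))
  (hcov : ∀ x : X, ∃ i, x ∈ E.nonvanishing (s i))
  {d e : ℕ} {F : Fin (d + 1 + 1) → MvPolynomial (Fin (N + 1)) k}
  (hF : ∀ j, F j ∈ grading (Fin (N + 1)) k e)
  (hcovF : ∀ x : X, ∃ j, x ∈ (e • E).nonvanishing (aeval s (F j)))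

include hs hF in
/-- The sections `t_j = F_j(s)` of `𝒪_X(e E)`. [folklore] -/
theorem isSection_aeval_forms (j : Fin (d + 1 + 1)) : (e • E).IsSection (aeval s (F j)) :=
  CartierDivisor.isSection_aeval hs ((MvPolynomial.mem_homogeneousSubmodule _ _).1 (hF j))

/-- The generic point lies in `X_{t_j}` as soon as this open is non-empty. [folklore] -/
theorem genericPoint_mem_nonvanishingOpens_aeval {j : Fin (d + 1 + 1)}
    (hne : ((e • E).nonvanishing (aeval s (F j))).Nonempty) :
    genericPoint X ∈ (e • E).nonvanishingOpens (aeval s (F j)) := by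
  obtain ⟨x, hx⟩ := hne
  exact CartierDivisor.genericPoint_mem_of_mem hx

/-- **The generating sections `t₀, …, t_{d+1}`** of `𝒪_X(e E)` (no common zero on `X`).
[folklore] -/
def formsGeneratingSections (hξF : ∀ j, genericPoint X ∈ (e • E).nonvanishingOpens (aeval s (F j))) :
    GeneratingSections (Fin (d + 1 + 1)) X :=
  (e • E).toGeneratingSections (fun j => aeval s (F j)) (isSection_aeval_forms hs hF) hξF hcovF

variable (hξF : ∀ j, genericPoint X ∈ (e • E).nonvanishingOpens (aeval s (F j)))

/-- The charts of the generating sections `t_j` are the `X_{t_j}`. [folklore] -/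
@[simp]
theorem formsGeneratingSections_U (j : Fin (d + 1 + 1)) :
    (formsGeneratingSections hs hF hcovF hξF).U j = (e • E).nonvanishingOpens (aeval s (F j)) := rfl

/-- **`π = (t₀ : … : t_{d+1}) : X → ℙ^{d+1}_k`**, the morphism defined by the generating
sections `t_j = F_j(s)` (Hartshorne II Thm. 7.1; Görtz–Wedhorn I, (13.12)).
[cite: DeJong1996, Lemma 4.11 (proof), p. 68] -/
def formsProjection : X ⟶ Proj (grading (Fin (d + 1 + 1)) k) :=
  (formsGeneratingSections hs hF hcovF hξF).toProj (X ↘ Spec (.of k))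

/-- `π` is a morphism over `k`. [folklore] -/
theorem formsProjection_toSpec :
    formsProjection hs hF hcovF hξF ≫ toSpec (Fin (d + 1 + 1)) k = X ↘ Spec (.of k) :=
  (formsGeneratingSections hs hF hcovF hξF).toProj_toSpec _

/-- **`π⁻¹ D₊(y_j) = X_{t_j}`.** [folklore] -/
theorem formsProjection_preimage_basicOpen (j : Fin (d + 1 + 1)) :
    formsProjection hs hF hcovF hξF ⁻¹ᵁ Proj.basicOpen (grading (Fin (d + 1 + 1)) k) (MvPolynomial.X j) =
      (e • E).nonvanishingOpens (aeval s (F j)) :=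
  (formsGeneratingSections hs hF hcovF hξF).toProj_preimage_basicOpen _ j

/-- `π(x) ∈ D₊(y_j)` iff `x ∈ X_{t_j}`. [folklore] -/
theorem formsProjection_apply_mem_basicOpen_iff (j : Fin (d + 1 + 1)) (x : X) :
    formsProjection hs hF hcovF hξF x ∈ Proj.basicOpen (grading (Fin (d + 1 + 1)) k) (MvPolynomial.X j) ↔
      x ∈ (e • E).nonvanishing (aeval s (F j)) := by
  change x ∈ formsProjection hs hF hcovF hξF ⁻¹ᵁ
      Proj.basicOpen (grading (Fin (d + 1 + 1)) k) (MvPolynomial.X j) ↔ _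
  rw [formsProjection_preimage_basicOpen hs hF hcovF hξF j]
  rfl

include hξ hcov in
/-- **`π` is an affine morphism** when the `X_{s_i}` are affine and `e ≥ 1` (`π⁻¹ D₊(y_j) = X_{t_j}`
is affine, `CartierDivisor.isAffineOpen_nonvanishingOpens_aeval`). [folklore] -/
theorem isAffineHom_formsProjection (haff : ∀ i, IsAffineOpen (E.nonvanishingOpens (s i)))
    (he : 0 < e) : IsAffineHom (formsProjection hs hF hcovF hξF) :=
  GeneratingSections.isAffineHom_toProj _ _ fun j =>
    E.isAffineOpen_nonvanishingOpens_aeval hs hξ hcov haff he (hF j)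

include hξ hcov in
/-- **`π` is finite** for `X` proper over `k` (affine and proper). [cite: GortzWedhorn2020, Thm. 13.89 (proof)] -/
theorem isFinite_formsProjection [IsProper (X ↘ Spec (.of k))]
    (haff : ∀ i, IsAffineOpen (E.nonvanishingOpens (s i))) (he : 0 < e) :
    IsFinite (formsProjection hs hF hcovF hξF) :=
  haveI := isAffineHom_formsProjection hs hξ hcov hF hcovF hξF haff he
  isFinite_of_isAffineHom_of_comp_eq _ (formsProjection_toSpec hs hF hcovF hξF)

include hξ hcov in
/-- **`π` is surjective** when `dim X = d + 1` (finite onto its closed image, of dimension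
`dim X = dim ℙ^{d+1}`). [folklore] -/
theorem surjective_formsProjection [IsProper (X ↘ Spec (.of k))]
    (haff : ∀ i, IsAffineOpen (E.nonvanishingOpens (s i))) (he : 0 < e)
    (hdim : topologicalKrullDim X = (d + 1 : ℕ)) : Surjective (formsProjection hs hF hcovF hξF) :=
  haveI := isFinite_formsProjection hs hξ hcov hF hcovF hξF haff he
  surjective_of_isFinite_of_dim _ hdim

/-- **`vertex ∉ π(Z)` as soon as `t₀, …, t_d` have no common zero on `Z`**: a point of `Z` lies
in some `X_{tₐ} = π⁻¹ D₊(yₐ)`, `a ≤ d`, and the vertex lies in no `D₊(yₐ)`, `a ≤ d`.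
[cite: DeJong1996, Lemma 4.11 (proof), p. 68] -/
theorem vertex_notMem_image_formsProjection {Z : Set X}
    (hZ : ∀ z ∈ Z, ∃ a : Fin (d + 1), z ∈ (e • E).nonvanishing (aeval s (F (Fin.castSucc a)))) :
    vertex d k ∉ formsProjection hs hF hcovF hξF '' Z := by
  rintro ⟨z, hz, hzv⟩
  obtain ⟨a, ha⟩ := hZ z hz
  have h : formsProjection hs hF hcovF hξF z ∈
      Proj.basicOpen (grading (Fin (d + 1 + 1)) k) (MvPolynomial.X (Fin.castSucc a)) :=
    (formsProjection_apply_mem_basicOpen_iff hs hF hcovF hξF (Fin.castSucc a) z).2 ha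
  rw [hzv] at h
  exact vertex_notMem_basicOpen d k a h

/-! ### `𝔪_vertex · 𝒪_{X,x}` at a point over the vertex -/

/-- A point over the vertex lies in `X_{t_{d+1}} = π⁻¹ D₊(y_{d+1})`. [folklore] -/
theorem mem_nonvanishingOpens_last_of_apply_eq_vertex {x : X}
    (hx : formsProjection hs hF hcovF hξF x = vertex d k) :
    x ∈ (e • E).nonvanishingOpens (aeval s (F (Fin.last (d + 1)))) := by
  rw [← formsProjection_preimage_basicOpen hs hF hcovF hξF]
  change formsProjection hs hF hcovF hξF x ∈
    Proj.basicOpen (grading (Fin (d + 1 + 1)) k) (MvPolynomial.X (Fin.last (d + 1)))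
  rw [hx]
  exact vertex_mem_basicOpen_last d k

/-- **`π^*(xₐ/x_{d+1}) = tₐ/t_{d+1}` at the level of germs**: the stalk map of `π` at `x` sends
the germ of the coordinate section `xₐ/x_{d+1}` at `π(x) ∈ D₊(x_{d+1})` to the germ at `x` of the
ratio `tₐ/t_{d+1} ∈ Γ(X_{t_{d+1}}, 𝒪_X)` (`GeneratingSections.app_sec`, Hartshorne II 7.1:
"`s_i = φ^*(x_i)`"). [cite: Hartshorne1977, II Thm. 7.1] -/
theorem stalkMap_germ_vertexSection {x : X}
    (hxP : formsProjection hs hF hcovF hξF x ∈ (lastChart d k : (Proj (grading (Fin (d + 1 + 1)) k)).Opens))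
    (hxU : x ∈ (e • E).nonvanishingOpens (aeval s (F (Fin.last (d + 1))))) (a : Fin (d + 1)) :
    ((formsProjection hs hF hcovF hξF).stalkMap x).hom
        (((Proj (grading (Fin (d + 1 + 1)) k)).presheaf.germ (lastChart d k) _ hxP).hom
          (vertexSection d k a)) =
      (X.presheaf.germ _ x hxU).hom
        ((formsGeneratingSections hs hF hcovF hξF).ratio (Fin.last (d + 1)) (Fin.castSucc a)) := by
  set G := formsGeneratingSections hs hF hcovF hξF with hG
  set π := formsProjection hs hF hcovF hξF with hπ
  -- `xₐ/x_{d+1}` as the section of the degree-zero fraction `xₐ/x_{d+1}`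
  have hsec : vertexSection d k a = ProjSpace.sec (Fin.last (d + 1)) (frac k (Fin.last (d + 1)) (Fin.castSucc a)) := by
    rw [vertexSection_eq, ProjSpace.sec_eq_awayToSection, ← PointBlowup.frac_succAbove_eq_chartGen,
      Fin.succAbove_last_apply]
  rw [Scheme.Hom.germ_stalkMap_apply, hsec]
  change (X.presheaf.germ (G.toProj (X ↘ Spec (.of k)) ⁻¹ᵁ ProjSpace.U (Fin.last (d + 1))) x hxP).hom
      ((G.toProj (X ↘ Spec (.of k))).app (ProjSpace.U (Fin.last (d + 1)))
        (ProjSpace.sec (Fin.last (d + 1)) (frac k (Fin.last (d + 1)) (Fin.castSucc a)))) = _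
  rw [GeneratingSections.app_sec, GeneratingSections.chartRingHom_frac,
    GeneratingSections.topIso_hom_res
      (le_of_eq (G.toProj_preimage_U (X ↘ Spec (.of k)) (Fin.last (d + 1))))]
  exact TopCat.Presheaf.germ_res_apply X.presheaf _ x _ _

/-- **For `x ∈ π⁻¹(vertex)`, `𝔪_vertex · 𝒪_{X,x}` is generated by the germs of the ratios
`tₐ/t_{d+1}`, `a ≤ d`.** Hence the stalk condition `𝔪_vertex 𝒪_{X,x} = 𝔪_x` of
`DeJong1996.Lemma411GoodProjection` ("`π` is étale over a neighbourhood of `p`") asks that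
`t₀/t_{d+1}, …, t_d/t_{d+1}` generate the maximal ideal of `𝒪_{X,x}` at every common zero `x`
of `t₀, …, t_d`. [cite: DeJong1996, Lemma 4.11 (proof), p. 68] -/
theorem map_maximalIdeal_formsProjection {x : X} (hx : formsProjection hs hF hcovF hξF x = vertex d k) :
    (maximalIdeal ((Proj (grading (Fin (d + 1 + 1)) k)).presheaf.stalk
        (formsProjection hs hF hcovF hξF x))).map ((formsProjection hs hF hcovF hξF).stalkMap x).hom =
      Ideal.span (Set.range fun a : Fin (d + 1) =>
        (X.presheaf.germ _ x (mem_nonvanishingOpens_last_of_apply_eq_vertex hs hF hcovF hξF hx)).hom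
          ((formsGeneratingSections hs hF hcovF hξF).ratio (Fin.last (d + 1)) (Fin.castSucc a))) := by
  have hxU := mem_nonvanishingOpens_last_of_apply_eq_vertex hs hF hcovF hξF hx
  -- generators of `𝔪_vertex`, transported to the point `π x = vertex`
  have key : ∀ (p : Proj (grading (Fin (d + 1 + 1)) k)) (hp : p = vertex d k)
      (hpU : p ∈ (lastChart d k : (Proj (grading (Fin (d + 1 + 1)) k)).Opens)),
      maximalIdeal ((Proj (grading (Fin (d + 1 + 1)) k)).presheaf.stalk p) =
        Ideal.span (Set.range fun a : Fin (d + 1) =>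
          ((Proj (grading (Fin (d + 1 + 1)) k)).presheaf.germ (lastChart d k) p hpU).hom
            (vertexSection d k a)) := by
    rintro p rfl hpU
    exact maximalIdeal_stalk_vertex d k
  have hxP : formsProjection hs hF hcovF hξF x ∈ (lastChart d k : (Proj (grading (Fin (d + 1 + 1)) k)).Opens) := by
    rw [hx]; exact vertex_mem_lastChart d k
  rw [key _ hx hxP, Ideal.map_span, ← Set.range_comp]
  exact congrArg Ideal.span (congrArg Set.range (funext fun a =>
    stalkMap_germ_vertexSection hs hF hcovF hξF hxP hxU a))

end Forms

end DeJong1996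

end Literature.AlgebraicGeometry.Resolution

end
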